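import Summits.BirchSwinnertonDyer.BirchSwinnertonDyer.Theorems.TwoAdicConverseLambdaHalfTwistRankDoor
import Summits.BirchSwinnertonDyer.Rank1Residual.Supersingular.RationalLadder
import Summits.BirchSwinnertonDyer.Rank1Residual.X10.CMPartnerMinimality
import Literature.NumberTheory.EllipticCurves.BSDInvariantsProofs
import HarnessLib

/-!
# Route `TwoAdicConverse` (rung S3), crux `OrdLambdaHalfAtTwo` (item 19556) AT THE CURVE `121c1` — the first «LH» row:
# the `λ`-half at a NON-census curve from PRINT {modularity} and three certificates, the twist-rank one DISCHARGED IN THE KERNEL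

Cell `bsd-2adic` (run/shared/lean/pub/bsd-2adic/), seat `bsd-2adic-conv-1` (GEN 9). THEOREMS ONLY — no definition, no named fact, no
axiom, no `sorry`. HONEST FRAMING: this file proves item 19556's per-curve predicate `LambdaHalfAtTwo W` at ONE curve modulo the displayed
binders; it closes no item and books nothing (the row species «LH» is unpriced); BSD is not proved by any of this. PARTITION (D-0054):
none — RANK axis (S3); the curve is NOT a class of the X5@2 census (`#Ш_an = 1`); types-the-object-of.

THE ROW. `W = 121c1` = `[1,1,0,-2,-7]` (Cremona's minimal model; conductor `N = 121 = 11²`, rank `0`, `#E(ℚ)_tors = 1`, so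
`E[2]` is irreducible; `(2/N) = +1`; good ordinary at `2`). Analytic side (CERT, two engines: PARI `msfromell` kit j270470 and eng-2's
ENGINE-2 `afe2_engine.gp` kit j273542): `λ_an = 2`, both zeros of `L₂(E,T)` at `T = −2` (`θ_m(−2) = 0`). Algebraic side: the quadratic
twist `E^{(2)}` — minimal model `M = [0,1,0,-161,-3137]`, conductor `64·N` — has Mordell–Weil rank `≥ 2`, PROVED HERE by the tree's
RED-pair checker (`two_le_mordellWeilRank_of_redPair`: points `P = (19,32)`, `Q = (51,352)`, `m = 2`, `ℓ₀ = 5` with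
`N_{ℓ₀} = 7` odd, certificate primes ℓ = 3 (N_ℓ = 6), ℓ = 3 (N_ℓ = 6), ℓ = 7 (N_ℓ = 10) for `P`, `P+Q`, `Q`; every multiple
computed in the kernel by the division-free `ℚ`-ladder of `RationalLadder.lean`), transported to the door's model
`W.quadraticTwist 2 = ⟨0, b₂/2, 0, 2b₄, 2b₆⟩ = ⟨2,3,0,0⟩ • M` (`mordellWeilRank_variableChange_holds`). DOOR: GEN 9's
`lambdaHalfAtTwo_of_natCard_selmerGroup_two_eq_one_of_analyticLambdaEq_le_twistRank` (p512943/p515404): `X(E/ℚ_∞)` is `Λ`-torsion by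
Mazur's Thm 1.4 (no Kato), `λ(L₀) = 2 ≤ rank E^{(2)}(ℚ) ≤ corank(E) + corank(E^{(2)}) ≤ λ(X)` (Greenberg 1.9 at `ℚ₁ = ℚ(√2)`, tree theorem).
DISPLAYED BINDERS of the final theorem: PRINT `hmod` (modularity); CERT `hper₀` (Néron integrality, INT2-AUTO), `hlan : AnalyticLambdaEq W 2 2`
(two-engine), `hSel : #Sel₂(E/ℚ) = 1` (2-descent: mwrank `selmer_rank = 0` and rank `0`, `Ш_an = 1`; kit j273941). NOTHING ELSE —
no Kato, no `μ`, no tower, no Greenberg 4.1/1.14/5.14, no Matsuno, no rank hypothesis.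

References: J. H. Silverman, GTM 106 (2009), VII.2.1, VII.3.1(b), VIII.6.7, X.5.4 [SilvermanAEC2009]; A. Kraus, Manuscripta Math. 65 (1989),
Prop. 1–2 [Kraus1989]; R. Greenberg, LNM 1716 (1999), Thm. 1.4, Thm. 1.9 [GreenbergLNM1716]; J. E. Cremona, *Algorithms for Modular Elliptic
Curves* (1997), Table 1 [Cremona2006].
-/

set_option linter.dupNamespace false
set_option autoImplicit false

noncomputable section

open scoped Classical
open CongruenceSubgroup WeierstrassCurve Literature.NumberTheory.EllipticCurves Literature.NumberTheory.EllipticCurves.ModularForms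
  Literature.NumberTheory.EllipticCurves.Rank1Residual
  Summit.BirchSwinnertonDyer.Rank1Residual.X1.MuLambda
  Summit.BirchSwinnertonDyer.Rank1Residual.X1.ParitySqueeze
  Summit.BirchSwinnertonDyer.BirchSwinnertonDyer.Theorems.Rank1ResidualX1Defs
  Summit.BirchSwinnertonDyer.Rank1Residual.X5 Summit.BirchSwinnertonDyer.Rank1Residual.X5.O1
  Summit.BirchSwinnertonDyer.BirchSwinnertonDyer.Rank1Residual.IntModel
  Summit.BirchSwinnertonDyer.Rank1Residual.Supersingular

namespace Summit.BirchSwinnertonDyer.BirchSwinnertonDyer.Theorems.TwoAdicTwistConverse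

/-! ## §1 The twist `E^{(2)}`: minimal model, ellipticity, minimality, and `2 ≤ rank` by a RED-pair certificate -/

/-- `M = [0,1,0,-161,-3137]` (Cremona's minimal model of `121c1^{(2)}`) is an elliptic curve (`Δ ≠ 0` decided). [cite: Cremona2006, Table 1] -/
theorem isElliptic_twistTwo_121c1 : (⟨0, 1, 0, -161, -3137⟩ : WeierstrassCurve ℚ).IsElliptic :=
  Summit.BirchSwinnertonDyer.Rank1Residual.X11b.isElliptic_of_discOf_ne_zero (0) (1) (0) (-161) (-3137) (by decide +kernel)

/-- `M` is globally minimal (Kraus' criterion, decided). [cite: Kraus1989, Prop. 1 and Prop. 2] [cite: SilvermanAEC2009, VII.1 Remark 1.1] -/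
theorem isGloballyMinimal_twistTwo_121c1 : (⟨0, 1, 0, -161, -3137⟩ : WeierstrassCurve ℚ).IsGloballyMinimal :=
  Summit.BirchSwinnertonDyer.Rank1Residual.X10.isGloballyMinimal_of_krausCriterion_bounded₃ (0) (1) (0) (-161) (-3137)
    (by decide +kernel) (by decide +kernel) (by decide +kernel) (by decide +kernel)
/-- **`2 ≤ rank 121c1^{(2)}(ℚ)` IN THE KERNEL** — RED-pair certificate (tree checker `two_le_mordellWeilRank_of_redPair`, `m = 2`): `P = (19, 32)`,
`Q = (51, 352)` on `M`; no rational `2`-torsion (`2 ∤ N_{5} = 7`); for `P`, `P + Q = (29, -132)` and `Q` a good odd prime `ℓ` with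
`2 ∣ N_ℓ` at which `(N_ℓ/2)·v` has `ℓ`-integral `x` — multiples by the division-free `ℚ`-ladder (`decide +kernel`).
[cite: SilvermanAEC2009, VII.2.1, VII.3.1(b), Thm. VIII.6.7] -/
theorem two_le_mordellWeilRank_twistTwo_121c1 : 2 ≤ (⟨0, 1, 0, -161, -3137⟩ : WeierstrassCurve ℚ).mordellWeilRank := by
  haveI := isElliptic_twistTwo_121c1
  haveI := isGloballyMinimal_twistTwo_121c1
  haveI : Fact (Nat.Prime 3) := ⟨by norm_num⟩
  haveI : Fact (Nat.Prime 5) := ⟨by norm_num⟩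
  haveI : Fact (Nat.Prime 7) := ⟨by norm_num⟩
  have hI : integralModelInt (⟨0, 1, 0, -161, -3137⟩ : WeierstrassCurve ℚ) = ⟨0, 1, 0, -161, -3137⟩ :=
    integralModelInt_eq_of_map_eq _ (by ext <;> simp [WeierstrassCurve.map])
  have hP : (⟨0, 1, 0, -161, -3137⟩ : WeierstrassCurve ℚ).toAffine.Nonsingular (19 : ℚ) (32 : ℚ) :=
    WeierstrassCurve.Affine.equation_iff_nonsingular.mp ((WeierstrassCurve.Affine.equation_iff _ _).mpr (by norm_num))
  have hQ : (⟨0, 1, 0, -161, -3137⟩ : WeierstrassCurve ℚ).toAffine.Nonsingular (51 : ℚ) (352 : ℚ) :=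
    WeierstrassCurve.Affine.equation_iff_nonsingular.mp ((WeierstrassCurve.Affine.equation_iff _ _).mpr (by norm_num))
  have hN3 : (⟨0, 1, 0, -161, -3137⟩ : WeierstrassCurve ℚ).reductionPointCount 3 = 6 :=
    reductionPointCount_eq_of_intModel_countPoints hI 3 (by norm_num) (by decide +kernel) (by decide +kernel)
  have hN5 : (⟨0, 1, 0, -161, -3137⟩ : WeierstrassCurve ℚ).reductionPointCount 5 = 7 :=
    reductionPointCount_eq_of_intModel_countPoints hI 5 (by norm_num) (by decide +kernel) (by decide +kernel)
  have hN7 : (⟨0, 1, 0, -161, -3137⟩ : WeierstrassCurve ℚ).reductionPointCount 7 = 10 :=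
    reductionPointCount_eq_of_intModel_countPoints hI 7 (by norm_num) (by decide +kernel) (by decide +kernel)
  refine two_le_mordellWeilRank_of_redPair _ (m := 2) (by norm_num) 5 (by norm_num)
    (not_dvd_minimalDiscriminantInt_of_intModel hI (by decide +kernel)) (by rw [hN5]; decide)
    (.some _ _ hP) (.some _ _ hQ) ?_ ?_
  · intro c hc
    interval_cases c
    · -- c = 0 at ℓ = 3: N_ℓ = 6, (N_ℓ/2) = 3
      have eV : (Affine.Point.some (19 : ℚ) (32 : ℚ) hP : (⟨0, 1, 0, -161, -3137⟩ : WeierstrassCurve ℚ).toAffine.Point) + 0 • .some (51 : ℚ) (352 : ℚ) hQ = .some (19 : ℚ) (32 : ℚ) hP := by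
        rw [zero_nsmul, add_zero]
      obtain ⟨hR, eR⟩ := nsmul_some_eq_of_ladderRunQ (W := (⟨0, 1, 0, -161, -3137⟩ : WeierstrassCurve ℚ)) (xf := ((854627 : ℚ) / 27889)) (yf := ((685207968 : ℚ) / 4657463)) hP
        [⟨true, (15 : ℚ), (186 : ℚ), (-2537 : ℚ), ((-2569 : ℚ) / 167), ((854627 : ℚ) / 27889), ((685207968 : ℚ) / 4657463)⟩] (by decide +kernel)
      rw [show qScalar 1 _ = 3 from by decide] at eR
      refine ⟨3, ⟨by norm_num⟩, by norm_num, not_dvd_minimalDiscriminantInt_of_intModel hI (by decide +kernel),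
        by rw [hN3]; decide, ((854627 : ℚ) / 27889), ((685207968 : ℚ) / 4657463), hR, ?_, by decide +kernel⟩
      rw [hN3]
      exact (congrArg (fun T : (⟨0, 1, 0, -161, -3137⟩ : WeierstrassCurve ℚ).toAffine.Point => (6 / 2 : ℕ) • T) eV).trans eR
    · -- c = 1 at ℓ = 3: N_ℓ = 6, (N_ℓ/2) = 3
      have eQc : (1 : ℕ) • (.some (51 : ℚ) (352 : ℚ) hQ : (⟨0, 1, 0, -161, -3137⟩ : WeierstrassCurve ℚ).toAffine.Point) = .some (51 : ℚ) (352 : ℚ) hQ := one_nsmul _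
      obtain ⟨hV, eV0⟩ := some_add_some_eq_of_addOKQ (W := (⟨0, 1, 0, -161, -3137⟩ : WeierstrassCurve ℚ)) (L := (10 : ℚ)) (x₃ := (29 : ℚ)) (y₃ := (-132 : ℚ)) hP hQ (by decide +kernel)
      have eV : (Affine.Point.some (19 : ℚ) (32 : ℚ) hP : (⟨0, 1, 0, -161, -3137⟩ : WeierstrassCurve ℚ).toAffine.Point) + 1 • .some (51 : ℚ) (352 : ℚ) hQ = .some (29 : ℚ) (-132 : ℚ) hV := by
        rw [eQc, eV0]
      obtain ⟨hR, eR⟩ := nsmul_some_eq_of_ladderRunQ (W := (⟨0, 1, 0, -161, -3137⟩ : WeierstrassCurve ℚ)) (xf := ((545477 : ℚ) / 169)) (yf := ((402929028 : ℚ) / 2197)) hV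
        [⟨true, ((-55 : ℚ) / 6), ((901 : ℚ) / 36), ((20647 : ℚ) / 216), ((-4469 : ℚ) / 78), ((545477 : ℚ) / 169), ((402929028 : ℚ) / 2197)⟩] (by decide +kernel)
      rw [show qScalar 1 _ = 3 from by decide] at eR
      refine ⟨3, ⟨by norm_num⟩, by norm_num, not_dvd_minimalDiscriminantInt_of_intModel hI (by decide +kernel),
        by rw [hN3]; decide, ((545477 : ℚ) / 169), ((402929028 : ℚ) / 2197), hR, ?_, by decide +kernel⟩
      rw [hN3]
      exact (congrArg (fun T : (⟨0, 1, 0, -161, -3137⟩ : WeierstrassCurve ℚ).toAffine.Point => (6 / 2 : ℕ) • T) eV).trans eR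
  · -- Q at ℓ = 7: N_ℓ = 10, (N_ℓ/2) = 5
    obtain ⟨hR, eR⟩ := nsmul_some_eq_of_ladderRunQ (W := (⟨0, 1, 0, -161, -3137⟩ : WeierstrassCurve ℚ)) (xf := ((2187363 : ℚ) / 28561)) (yf := ((3200290016 : ℚ) / 4826809)) hQ
      [⟨false, (11 : ℚ), (18 : ℚ), (11 : ℚ), (0 : ℚ), (0 : ℚ), (0 : ℚ)⟩, ⟨true, ((77 : ℚ) / 2), ((5781 : ℚ) / 4), ((-439681 : ℚ) / 8), ((-13409 : ℚ) / 338), ((2187363 : ℚ) / 28561), ((3200290016 : ℚ) / 4826809)⟩] (by decide +kernel)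
    rw [show qScalar 1 _ = 5 from by decide] at eR
    refine ⟨7, ⟨by norm_num⟩, by norm_num, not_dvd_minimalDiscriminantInt_of_intModel hI (by decide +kernel),
      by rw [hN7]; decide, ((2187363 : ℚ) / 28561), ((3200290016 : ℚ) / 4826809), hR, ?_, by decide +kernel⟩
    rw [hN7]
    exact eR

/-! ## §2 The door's model `W.quadraticTwist 2` is `⟨2,3,0,0⟩ • M`; rank transport -/

/-- `121c1` (Cremona's minimal model `[1,1,0,-2,-7]`) is an elliptic curve. [cite: Cremona2006, Table 1] -/
theorem isElliptic_121c1 : (⟨1, 1, 0, -2, -7⟩ : WeierstrassCurve ℚ).IsElliptic :=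
  Summit.BirchSwinnertonDyer.Rank1Residual.X11b.isElliptic_of_discOf_ne_zero (1) (1) (0) (-2) (-7) (by decide +kernel)

/-- `121c1` is globally minimal (Kraus' criterion, decided). [cite: Kraus1989, Prop. 1 and Prop. 2] -/
theorem isGloballyMinimal_121c1 : (⟨1, 1, 0, -2, -7⟩ : WeierstrassCurve ℚ).IsGloballyMinimal :=
  Summit.BirchSwinnertonDyer.Rank1Residual.X10.isGloballyMinimal_of_krausCriterion_bounded₃ (1) (1) (0) (-2) (-7)
    (by decide +kernel) (by decide +kernel) (by decide +kernel) (by decide +kernel)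

/-- The tree's model of the quadratic twist by `2`, `W.quadraticTwist 2 = ⟨0, b₂/2, 0, 2b₄, 2b₆⟩`, is the change of variables `⟨u,r,s,t⟩ = ⟨2,3,0,0⟩`
of Cremona's minimal model `M` (Silverman III.1 formulas, `norm_num`). [cite: SilvermanAEC2009, III.1 Table 3.1] -/
theorem quadraticTwist_two_eq_smul_121c1 :
    (⟨1, 1, 0, -2, -7⟩ : WeierstrassCurve ℚ).quadraticTwist 2 = (⟨Units.mk0 (2 : ℚ) (by norm_num), 3, 0, 0⟩ : VariableChange ℚ) • (⟨0, 1, 0, -161, -3137⟩ : WeierstrassCurve ℚ) := by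
  ext <;> simp only [quadraticTwist_a₁, quadraticTwist_a₂, quadraticTwist_a₃, quadraticTwist_a₄, quadraticTwist_a₆,
    WeierstrassCurve.b₂, WeierstrassCurve.b₄, WeierstrassCurve.b₆, variableChange_a₁, variableChange_a₂, variableChange_a₃,
    variableChange_a₄, variableChange_a₆, Units.val_inv_eq_inv_val, Units.val_mk0] <;> norm_num

/-- **`2 ≤ rank 121c1^{(2)}(ℚ)` on the door's model** (`mordellWeilRank_variableChange_holds`). [cite: SilvermanAEC2009, III.3.1(b) and VIII.6] -/
theorem two_le_mordellWeilRank_quadraticTwist_two_121c1 : 2 ≤ ((⟨1, 1, 0, -2, -7⟩ : WeierstrassCurve ℚ).quadraticTwist 2).mordellWeilRank := by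
  rw [quadraticTwist_two_eq_smul_121c1]
  haveI := isElliptic_twistTwo_121c1
  have h := mordellWeilRank_variableChange_holds (⟨0, 1, 0, -161, -3137⟩ : WeierstrassCurve ℚ) (⟨Units.mk0 (2 : ℚ) (by norm_num), 3, 0, 0⟩ : VariableChange ℚ)
  unfold mordellWeilRank_variableChange at h
  rw [h]
  exact two_le_mordellWeilRank_twistTwo_121c1

/-! ## §3 The row: `LambdaHalfAtTwo 121c1` from PRINT {hmod} + CERT {hper₀, λ_an = 2, #Sel₂ = 1} -/

/-- **Item 19556's predicate at `121c1`**: `LambdaHalfAtTwo W` for `W = [1,1,0,-2,-7]`, from PRINT {modularity `hmod`} and CERT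
{`hper₀` (Néron integrality of `ϖ`, INT2-AUTO), `hlan : λ_an = 2` (two-engine), `hSel : #Sel₂(E/ℚ) = 1` (2-descent)}; the twist-rank input
`2 ≤ rank E^{(2)}(ℚ)` is the kernel theorem of §2 and «`X` torsion» is Mazur's Thm 1.4 (door p512943/p515404). Not a census class;
books nothing. [cite: GreenbergLNM1716, Thm. 1.4 (p. 60) and Thm. 1.9 (p. 63)] [cite: DokchitserDokchitserAnnals2010, Lemma 4.14]
[cite: SilvermanAEC2009, Thm X.4.2] -/
theorem lambdaHalfAtTwo_121c1 [(⟨1, 1, 0, -2, -7⟩ : WeierstrassCurve ℚ).IsElliptic] [(⟨1, 1, 0, -2, -7⟩ : WeierstrassCurve ℚ).IsGloballyMinimal]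
    (hmod : nonempty_modularParametrizationData)
    (hper₀ : ∀ [NeZero ((⟨1, 1, 0, -2, -7⟩ : WeierstrassCurve ℚ).conductorNorm ℤ)] (f : CuspForm (Gamma0 ((⟨1, 1, 0, -2, -7⟩ : WeierstrassCurve ℚ).conductorNorm ℤ)) 2),
      IsNewformOf (⟨1, 1, 0, -2, -7⟩ : WeierstrassCurve ℚ) f → ∀ ϖ : ℚ, (ϖ : ℝ) * (⟨1, 1, 0, -2, -7⟩ : WeierstrassCurve ℚ).realPeriodRat = plusPeriod f → 0 ≤ padicValRat 2 ϖ)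
    (hSel : Nat.card ((⟨1, 1, 0, -2, -7⟩ : WeierstrassCurve ℚ).selmerGroup 2) = 1) (hlan : AnalyticLambdaEq (⟨1, 1, 0, -2, -7⟩ : WeierstrassCurve ℚ) 2 2) :
    LambdaHalfAtTwo (⟨1, 1, 0, -2, -7⟩ : WeierstrassCurve ℚ) :=
  lambdaHalfAtTwo_of_natCard_selmerGroup_two_eq_one_of_analyticLambdaEq_le_twistRank _ hmod hper₀ hSel hlan
    (le_trans (by norm_num) two_le_mordellWeilRank_quadraticTwist_two_121c1)

end Summit.BirchSwinnertonDyer.BirchSwinnertonDyer.Theorems.TwoAdicTwistConverse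

end
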